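/-
Copyright (c) 2026. Released under the Apache 2.0 license.
-/
import Literature.NumberTheory.EllipticCurves.DivisionPolynomialFormalMulProofs
import Literature.NumberTheory.EllipticCurves.ManinConstantSemistableTwistSharpProofs
import HarnessLib

/-!
# `[3]` in characteristic `3`: the height dichotomy with explicit unit coefficients, and
# `‖q‖₃ ≤ 1` from a good twist

[Proofs] Theorems only (no definition, no named fact). For a nonsingular Weierstrass cubic `V`
over a field of characteristic `3`:

* `hasseCoeff_three : A₃(V) = b₂` and `coeff_three_formalMul_three : [z³][3](z) = b₂` (any ring
  of characteristic `3`; the tree's Katz–Mazur congruence `exists_formalMul_prime_eq_X_pow_mul`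
  at `ℓ = 3`) — the ORDINARY case: `b₂ ≠ 0` ⇒ unit coefficient in degree `3`;
* `exists_formalMul_three_eq_X_pow_nine_mul` — the SUPERSINGULAR case `b₂ = 0` over a domain of
  characteristic `3` with `Δ ≠ 0`: **`[3](z) = z⁹·g(z)` with `g(0)² = b₈² ≠ 0`** (`b₈ = −b₄²`,
  `Δ = b₄³`). The proof reads the tree's division-polynomial identity
  `sum_ΨSq_mul_formalXMulSq_subst_formalMul` ((∗): `ΨSq₃(x(z))·z²x([3]z)·z¹⁶ = Φ₃(x(z))·[3](z)²·…`)
  with `ΨSq₃ = Ψ₃² = b₈²` CONSTANT (`Ψ₃ = 3x⁴ + b₂x³ + 3b₄x² + 3b₆x + b₈`): the left side is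
  `z¹⁸(b₈² + O(z))`, the right side `z^{2ν}(c² + O(z))` for `[3] = cz^ν + ⋯`, so `ν = 9`, `c = ±b₈`
  — no isogenies, no Frobenius, no algebraic closure;
* `isUnit_coeff_formalMul_three_or` — the dichotomy: `[z³][3]` is a unit, or `[zⁿ][3] = 0` for
  `n < 9` and `[z⁹][3]` is a unit (Silverman IV.7.5 "height `1` or `2`", made explicit at `p = 3`).

Application to the local programme of the fact
`Literature.NumberTheory.EllipticCurves.edixhoven_int_of_neronLattice_eq_smul_periodLattice`
(`NeronIsogenyScaling.lean`) at the additive prime `3`: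

* `padicNorm_le_one_of_neronLattice_eq_smul_periodLattice_of_goodTwist_three` — given ANY twist
  datum `(K, π, e, k, r, s, t, V'')` of the Newton-polygon ender `…_of_semistableTwist_sharp`
  (`ManinConstantSemistableTwistSharpProofs`) in which the `O`-model `V''` has GOOD reduction and
  `8k < 9e`, one has `‖q‖₃ ≤ 1` (unit coefficient in degree `3` with `2k < 3e`, or in degree `9`
  with `8k < 9e`). For a twist acquiring good reduction `k/e = v₃(Δ_min)/12`, and `v₃(Δ_min) ≤ 13`
  for a minimal potentially good `W'` (Kraus, `KrausNonMinimalityTwoThreeProofs`), so `8k < 9e`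
  always: what remains at `p = 3` is only the CONSTRUCTION of a good twist over some finite
  `K/ℚ_3` (the potentially multiplicative types are `ManinConstantPotMultiplicativeProofs`).

## References
* [SilvermanAEC2009] J. H. Silverman, *The Arithmetic of Elliptic Curves*, 2nd ed., GTM 106
  (2009): IV.4.4, IV.7.5 (height `1` or `2`), V.3.1, V.4.1 (Hasse invariant), Exercise 3.7
  (division polynomials), VII.5.4–5.5.
* [KatzMazur1985] N. M. Katz, B. Mazur, *Arithmetic Moduli of Elliptic Curves* (1985), 12.4.2.
* [EdixhovenManin1991] B. Edixhoven, *On the Manin constants of modular elliptic curves*,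
  Progr. Math. 89 (1991), 25–39, Prop. 2.
-/

noncomputable section

open scoped Classical
open PowerSeries Polynomial Literature.NumberTheory.EllipticCurves

namespace WeierstrassCurve

/-! ### Characteristic `3`: `A₃ = b₂`, and the supersingular case `b₂ = 0` -/

section CharThree

variable {S : Type*} [CommRing S] (V : WeierstrassCurve S)

/-- **`A₃(V) = b₂`**: the Hasse invariant in characteristic `3` is `b₂` (the coefficient of `x²` in
`4x³ + b₂x² + 2b₄x + b₆`). [cite: SilvermanAEC2009, V.4.1] -/
theorem hasseCoeff_three : V.hasseCoeff 3 = V.b₂ := by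
  rw [hasseCoeff, show (3 - 1) / 2 = 1 from rfl, show 3 - 1 = 2 from rfl, pow_one, Cubic.coeff_eq_b]
  rfl

variable [CharP S 3]

/-- **`[z³][3](z) = b₂` in characteristic `3`** (Katz–Mazur 12.4.2 / AEC IV.4.4 at `ℓ = 3`, with
`A₃ = b₂`). [cite: SilvermanAEC2009, IV.4.4] -/
theorem coeff_three_formalMul_three : PowerSeries.coeff 3 (V.formalMul 3) = V.b₂ := by
  haveI : Fact (Nat.Prime 3) := ⟨Nat.prime_three⟩
  obtain ⟨h, hh, hh0⟩ := V.exists_formalMul_prime_eq_X_pow_mul 3 (by decide)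
  rw [hh, PowerSeries.coeff_X_pow_mul', if_pos le_rfl, Nat.sub_self,
    PowerSeries.coeff_zero_eq_constantCoeff_apply, hh0, hasseCoeff_three]

/-- `[zⁿ][3](z) = 0` for `0 < n < 3`... and indeed for all `n < 3`, in characteristic `3`.
[cite: SilvermanAEC2009, IV.4.4] -/
theorem coeff_formalMul_three_of_lt_three {n : ℕ} (hn : n < 3) :
    PowerSeries.coeff n (V.formalMul 3) = 0 := by
  haveI : Fact (Nat.Prime 3) := ⟨Nat.prime_three⟩
  obtain ⟨h, hh, -⟩ := V.exists_formalMul_prime_eq_X_pow_mul 3 (by decide)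
  rw [hh, PowerSeries.coeff_X_pow_mul', if_neg (not_le.mpr hn)]

/-- In characteristic `3`: `Ψ₃ = b₈` (a constant) when `b₂ = 0`. [folklore] -/
theorem Ψ₃_of_b₂_eq_zero (hb₂ : V.b₂ = 0) : V.Ψ₃ = Polynomial.C V.b₈ := by
  have h3 : (3 : S[X]) = 0 := by simpa using CharP.cast_eq_zero S[X] 3
  rw [Ψ₃, hb₂, map_zero, h3]
  ring

/-- In characteristic `3`: `b₈ = −b₄²` when `b₂ = 0`. [folklore] -/
theorem b₈_of_b₂_eq_zero (hb₂ : V.b₂ = 0) : V.b₈ = -V.b₄ ^ 2 := by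
  rw [V.b_relation_of_char_three, hb₂, zero_mul, zero_sub]

/-- In characteristic `3`: `Δ = b₄³` when `b₂ = 0`. [folklore] -/
theorem Δ_of_b₂_eq_zero (hb₂ : V.b₂ = 0) : V.Δ = V.b₄ ^ 3 := by
  rw [V.Δ_of_char_three, hb₂]
  linear_combination (-3 * V.b₄ ^ 3) * CharP.cast_eq_zero S 3

variable [IsDomain S]

/-- In characteristic `3` (domain): `b₂ = 0`, `Δ ≠ 0` ⇒ `b₈ ≠ 0`. [folklore] -/
theorem b₈_ne_zero_of_b₂_eq_zero (hb₂ : V.b₂ = 0) (hΔ : V.Δ ≠ 0) : V.b₈ ≠ 0 := by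
  rw [V.b₈_of_b₂_eq_zero hb₂, neg_ne_zero]
  intro h
  apply hΔ
  rw [V.Δ_of_b₂_eq_zero hb₂, pow_eq_zero_iff two_ne_zero |>.mp h, zero_pow three_ne_zero]

/-- **`[3](z) = ±b₈·z⁹ + O(z¹⁰)` for a supersingular curve in characteristic `3`.** Over an
integral domain of characteristic `3`, if `b₂ = 0` (vanishing Hasse invariant) and `Δ ≠ 0`, then
`[3](z) = z⁹·g(z)` with `g(0)² = b₈² ≠ 0`: the formal group has height EXACTLY `2` with an
explicit unit leading coefficient. Proof: in the division-polynomial identity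
`ΨSq₃(x(z))·x([3]z)·… = Φ₃(x(z))·…` (the tree's `sum_ΨSq_mul_formalXMulSq_subst_formalMul`, (∗)
with `n = 3`) one has `ΨSq₃ = Ψ₃² = b₈²` (a nonzero constant: `Ψ₃ = 3x⁴ + b₂x³ + 3b₄x² + 3b₆x +
b₈`), so the left side is `z¹⁸·(b₈² + O(z))`, while the right side is `z^{2ν}·(c² + O(z))` if
`[3] = c·z^ν + ⋯`; hence `ν = 9`, `c² = b₈²`. [cite: SilvermanAEC2009, IV.7.5, V.3.1, Exercise 3.7] -/
theorem exists_formalMul_three_eq_X_pow_nine_mul (hb₂ : V.b₂ = 0) (hΔ : V.Δ ≠ 0) :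
    ∃ g : S⟦X⟧, V.formalMul 3 = PowerSeries.X ^ 9 * g ∧
      PowerSeries.constantCoeff g ^ 2 = V.b₈ ^ 2 := by
  have hb₈ := V.b₈_ne_zero_of_b₂_eq_zero hb₂ hΔ
  have key := V.sum_ΨSq_mul_formalXMulSq_subst_formalMul 3
  have hΨ : V.ΨSq ((3 : ℕ) : ℤ) = Polynomial.C (V.b₈ ^ 2) := by
    rw [Nat.cast_ofNat, ΨSq_three, V.Ψ₃_of_b₂_eq_zero hb₂, ← map_pow]
  -- the left sum is `C(b₈²)·X¹⁶`
  have hL : (∑ i ∈ Finset.range (3 ^ 2),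
      PowerSeries.C ((V.ΨSq ((3 : ℕ) : ℤ)).coeff i) * V.formalXMulSq ^ i * PowerSeries.X ^ (2 * (3 ^ 2 - 1 - i))) =
        PowerSeries.C (V.b₈ ^ 2) * PowerSeries.X ^ 16 := by
    rw [Finset.sum_eq_single 0]
    · rw [hΨ, Polynomial.coeff_C_zero, pow_zero, mul_one]
      norm_num
    · intro i _ hi
      rw [hΨ, Polynomial.coeff_C, if_neg hi, map_zero, zero_mul, zero_mul]
    · intro h
      exact absurd (Finset.mem_range.mpr (by norm_num)) h
  -- constant coefficients
  have hu1 : PowerSeries.constantCoeff (V.formalXMulSq.subst (V.formalMul 3)) = 1 := by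
    rw [constantCoeff_subst_eq_constantCoeff (V.constantCoeff_formalMul 3), constantCoeff_formalXMulSq]
  have hΦ1 : PowerSeries.constantCoeff (∑ i ∈ Finset.range (3 ^ 2 + 1),
      PowerSeries.C ((V.Φ ((3 : ℕ) : ℤ)).coeff i) * V.formalXMulSq ^ i * PowerSeries.X ^ (2 * (3 ^ 2 - i))) = 1 := by
    rw [map_sum, Finset.sum_eq_single (3 ^ 2)]
    · rw [map_mul, map_mul, map_pow, map_pow, PowerSeries.constantCoeff_C, constantCoeff_formalXMulSq,
        one_pow, mul_one, Nat.sub_self, mul_zero, pow_zero, mul_one]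
      have := V.coeff_Φ (3 : ℕ)
      rwa [Int.natAbs_natCast] at this
    · intro i hi hne
      rw [Finset.mem_range] at hi
      have hpos : 2 * (3 ^ 2 - i) ≠ 0 := by omega
      rw [map_mul, map_pow, PowerSeries.constantCoeff_X, zero_pow hpos, mul_zero]
    · intro hnot
      exact absurd (Finset.mem_range.mpr (Nat.lt_succ_self _)) hnot
  -- `[3] ≠ 0`
  have hne : V.formalMul 3 ≠ 0 := by
    intro h0
    rw [h0, zero_pow two_ne_zero, mul_zero, hL] at key
    have h1 : V.formalXMulSq.subst (0 : S⟦X⟧) ≠ 0 := by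
      intro h'
      have := hu1
      rw [h0, h', map_zero] at this
      exact zero_ne_one this
    have h2 : PowerSeries.C (V.b₈ ^ 2) * PowerSeries.X ^ 16 * PowerSeries.X ^ 2 ≠ 0 :=
      mul_ne_zero (mul_ne_zero (fun h' ↦ pow_ne_zero 2 hb₈ (by
          have := congrArg PowerSeries.constantCoeff h'
          rwa [PowerSeries.constantCoeff_C, map_zero] at this))
        (pow_ne_zero _ PowerSeries.X_ne_zero)) (pow_ne_zero _ PowerSeries.X_ne_zero)
    exact mul_ne_zero h2 h1 key
  -- the order `m` of `[3]` and `[3] = X^m · g`, `g(0) ≠ 0`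
  have hex : ∃ m, PowerSeries.coeff m (V.formalMul 3) ≠ 0 := by
    by_contra hall
    apply hne
    ext m
    rw [map_zero]
    by_contra hm
    exact hall ⟨m, hm⟩
  set m := Nat.find hex with hm
  have hmspec : PowerSeries.coeff m (V.formalMul 3) ≠ 0 := Nat.find_spec hex
  have hmmin : ∀ i < m, PowerSeries.coeff i (V.formalMul 3) = 0 := fun i hi ↦ by
    have := Nat.find_min hex (hm ▸ hi)
    rwa [not_not] at this
  obtain ⟨g, hg⟩ := (PowerSeries.X_pow_dvd_iff (n := m)).mpr hmmin
  have hg0 : PowerSeries.constantCoeff g = PowerSeries.coeff m (V.formalMul 3) := by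
    rw [hg, PowerSeries.coeff_X_pow_mul', if_pos le_rfl, Nat.sub_self,
      PowerSeries.coeff_zero_eq_constantCoeff_apply]
  -- compare the two sides
  have hR : (∑ i ∈ Finset.range (3 ^ 2 + 1),
      PowerSeries.C ((V.Φ ((3 : ℕ) : ℤ)).coeff i) * V.formalXMulSq ^ i * PowerSeries.X ^ (2 * (3 ^ 2 - i))) *
        V.formalMul 3 ^ 2 = PowerSeries.X ^ (2 * m) * ((∑ i ∈ Finset.range (3 ^ 2 + 1),
      PowerSeries.C ((V.Φ ((3 : ℕ) : ℤ)).coeff i) * V.formalXMulSq ^ i * PowerSeries.X ^ (2 * (3 ^ 2 - i))) * g ^ 2) := by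
    rw [hg]; ring
  have hL' : PowerSeries.C (V.b₈ ^ 2) * PowerSeries.X ^ 16 * PowerSeries.X ^ 2 *
      V.formalXMulSq.subst (V.formalMul 3) =
        PowerSeries.X ^ 18 * (PowerSeries.C (V.b₈ ^ 2) * V.formalXMulSq.subst (V.formalMul 3)) := by
    ring
  rw [hL, hR, hL'] at key
  have hF0 : PowerSeries.constantCoeff (PowerSeries.C (V.b₈ ^ 2) * V.formalXMulSq.subst (V.formalMul 3)) ≠ 0 := by
    rw [map_mul, hu1, mul_one, PowerSeries.constantCoeff_C]; exact pow_ne_zero 2 hb₈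
  have hG0 : PowerSeries.constantCoeff ((∑ i ∈ Finset.range (3 ^ 2 + 1),
      PowerSeries.C ((V.Φ ((3 : ℕ) : ℤ)).coeff i) * V.formalXMulSq ^ i * PowerSeries.X ^ (2 * (3 ^ 2 - i))) * g ^ 2) ≠ 0 := by
    rw [map_mul, hΦ1, one_mul, map_pow, hg0]; exact pow_ne_zero 2 hmspec
  obtain ⟨he, hce⟩ := eq_and_constantCoeff_eq_of_X_pow_mul_eq key hF0 hG0
  rw [map_mul, hu1, mul_one, PowerSeries.constantCoeff_C, map_mul, hΦ1, one_mul, map_pow] at hce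
  have hm9 : m = 9 := by omega
  refine ⟨g, by rw [← hm9]; exact hg, hce.symm⟩

/-- `[zⁿ][3](z) = 0` for `n < 9` on a supersingular curve in characteristic `3`.
[cite: SilvermanAEC2009, IV.7.5] -/
theorem coeff_formalMul_three_of_lt_nine (hb₂ : V.b₂ = 0) (hΔ : V.Δ ≠ 0) {n : ℕ} (hn : n < 9) :
    PowerSeries.coeff n (V.formalMul 3) = 0 := by
  obtain ⟨g, hg, -⟩ := V.exists_formalMul_three_eq_X_pow_nine_mul hb₂ hΔ
  rw [hg, PowerSeries.coeff_X_pow_mul', if_neg (not_le.mpr hn)]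

/-- `([z⁹][3](z))² = b₈² ≠ 0` on a supersingular curve in characteristic `3`.
[cite: SilvermanAEC2009, IV.7.5] -/
theorem coeff_nine_formalMul_three_sq (hb₂ : V.b₂ = 0) (hΔ : V.Δ ≠ 0) :
    PowerSeries.coeff 9 (V.formalMul 3) ^ 2 = V.b₈ ^ 2 := by
  obtain ⟨g, hg, hg2⟩ := V.exists_formalMul_three_eq_X_pow_nine_mul hb₂ hΔ
  rw [hg, PowerSeries.coeff_X_pow_mul', if_pos le_rfl, Nat.sub_self,
    PowerSeries.coeff_zero_eq_constantCoeff_apply, hg2]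

/-- `[z⁹][3](z) ≠ 0` on a supersingular curve in characteristic `3`. [cite: SilvermanAEC2009, IV.7.5] -/
theorem coeff_nine_formalMul_three_ne_zero (hb₂ : V.b₂ = 0) (hΔ : V.Δ ≠ 0) :
    PowerSeries.coeff 9 (V.formalMul 3) ≠ 0 := by
  intro h
  have h2 := V.coeff_nine_formalMul_three_sq hb₂ hΔ
  rw [h, zero_pow two_ne_zero] at h2
  exact pow_ne_zero 2 (V.b₈_ne_zero_of_b₂_eq_zero hb₂ hΔ) h2.symm

end CharThree

/-! ### The height dichotomy over a field of characteristic `3` -/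

section Field

variable {k : Type*} [Field k] [CharP k 3] (V : WeierstrassCurve k)

/-- **Height dichotomy in characteristic `3` with explicit unit coefficients.** For a nonsingular
Weierstrass cubic over a field of characteristic `3`: either `[z³][3] = b₂` is a unit (ordinary,
height `1`) or `b₂ = 0`, the coefficients of `[3]` below degree `9` vanish and `[z⁹][3] = ±b₈` is
a unit (supersingular, height `2`). [cite: SilvermanAEC2009, IV.7.5, V.3.1] -/
theorem isUnit_coeff_formalMul_three_or (hΔ : V.Δ ≠ 0) :
    IsUnit (PowerSeries.coeff 3 (V.formalMul 3)) ∨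
      ((∀ n < 9, PowerSeries.coeff n (V.formalMul 3) = 0) ∧
        IsUnit (PowerSeries.coeff 9 (V.formalMul 3))) := by
  by_cases hb₂ : V.b₂ = 0
  · exact Or.inr ⟨fun n hn ↦ V.coeff_formalMul_three_of_lt_nine hb₂ hΔ hn,
      (V.coeff_nine_formalMul_three_ne_zero hb₂ hΔ).isUnit⟩
  · left
    rw [V.coeff_three_formalMul_three]
    exact Ne.isUnit hb₂

end Field

end WeierstrassCurve

/-! ### Application: `‖q‖₃ ≤ 1` from a good twist at `3` -/

namespace Literature.NumberTheory.EllipticCurves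

open scoped IntermediateField
open Literature.NumberTheory.GaloisRepresentations IsLocalRing _root_.WeierstrassCurve
open Literature.NumberTheory.EllipticCurves.ModularForms Literature.NumberTheory.Automorphic
open scoped MatrixGroups ModularForm
open CongruenceSubgroup

/-- **`‖q‖₃ ≤ 1` from a twist with good reduction and `8k < 9e`.** For the data of the fact
`edixhoven_int_of_neronLattice_eq_smul_periodLattice` at an additive prime `3` (`3 ∣ Δ_min`,
`3 ∣ c₄`), suppose given a finite extension `K/ℚ_3` with ring of integers `O`, `π ∈ K` with
`‖π‖ᵉ = 3⁻¹`, and an `O`-model `V''` with GOOD reduction (`Δ(V'') ∈ O^×`) of the twist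
`V'' ⊗ K = (πᵏ, r, s, t) • (W' ⊗ K)`, `r, s, t ∈ O`, with `8k < 9e` (for a twist acquiring
good reduction `k/e = v₃(Δ_min)/12`, so this is `v₃(Δ_min) ≤ 13` — automatic for a minimal
potentially good `W'` by Kraus). Then `‖q‖₃ ≤ 1`: by the height dichotomy
`isUnit_coeff_formalMul_three_or` for the reduction of `V''`, `[3]_{V''}` has a unit coefficient in
degree `3` (and `2k < 3e`) or in degree `9` (and `8k < 9e`), and `…_of_semistableTwist_sharp`
applies. [cite: EdixhovenManin1991, Prop. 2] [cite: SilvermanAEC2009, IV.7.5, VII.5.4] -/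
theorem padicNorm_le_one_of_neronLattice_eq_smul_periodLattice_of_goodTwist_three
    {N : ℕ} [NeZero N]
    {W' : WeierstrassCurve ℚ} [W'.IsElliptic] [W'.IsGloballyMinimal] {f : CuspForm (Gamma0 N) 2}
    {L' : PeriodPair} (hf : IsNewformOf W' f) (hL' : IsNeronLatticeOf (W'.baseChange ℂ) L')
    {q : ℚ} (hq : ∀ z ∈ periodLattice f, (q : ℂ) * z ∈ L'.lattice)
    (hq' : ∀ z ∈ L'.lattice, ∃ w ∈ periodLattice f, z = q * w)
    [hp : Fact (Nat.Prime 3)]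
    (hΔ : (3 : ℤ) ∣ minimalDiscriminantInt W') (hc₄ : (3 : ℤ) ∣ (integralModelInt W').c₄)
    (K : IntermediateField ℚ_[3] (PadicAlgCl 3)) [FiniteDimensional ℚ_[3] K] (πu : Kˣ) {e k : ℕ}
    (hπe : ‖((πu : K) : PadicAlgCl 3)‖ ^ e = (3 : ℝ)⁻¹) (r s t : padicCoeffRing K)
    (V'' : WeierstrassCurve (padicCoeffRing K))
    (hV'' : V''.map (algebraMap (padicCoeffRing K) K) =
      (⟨πu ^ k, (r : K), (s : K), (t : K)⟩ : VariableChange K) • W'.map (algebraMap ℚ K))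
    (hgood : IsUnit V''.Δ) (hke : 8 * k < 9 * e) : ‖(q : ℚ_[3])‖ ≤ 1 := by
  letI hOloc : IsLocalRing (padicCoeffRing K) := isLocalRing_padicCoeffRing K
  letI hOch : CharP (ResidueField (padicCoeffRing K)) 3 := charP_residueField_padicCoeffRing K
  set Vr := V''.map (residue (padicCoeffRing K)) with hVr
  have hΔr : Vr.Δ ≠ 0 := by
    rw [hVr, map_Δ]
    exact (residue_ne_zero_iff_isUnit _).mpr hgood
  have hp3 : ((3 : ℕ) : ℤ) = 3 := rfl
  rcases Vr.isUnit_coeff_formalMul_three_or hΔr with h3 | ⟨-, h9⟩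
  · refine padicNorm_le_one_of_neronLattice_eq_smul_periodLattice_of_semistableTwist_sharp hf hL'
      hq hq' (p := 3) (by exact_mod_cast hΔ) (by exact_mod_cast hc₄) K πu hπe r s t V'' hV''
      ⟨3, by norm_num, ?_, by omega⟩
    rw [← residue_ne_zero_iff_isUnit, ← PowerSeries.coeff_map, map_formalMul, ← hVr]
    exact h3.ne_zero
  · refine padicNorm_le_one_of_neronLattice_eq_smul_periodLattice_of_semistableTwist_sharp hf hL'
      hq hq' (p := 3) (by exact_mod_cast hΔ) (by exact_mod_cast hc₄) K πu hπe r s t V'' hV''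
      ⟨9, by norm_num, ?_, by omega⟩
    have h9' : IsUnit (PowerSeries.coeff (3 ^ 2) (Vr.formalMul 3)) := h9
    rw [← residue_ne_zero_iff_isUnit, ← PowerSeries.coeff_map, map_formalMul, ← hVr]
    exact h9.ne_zero

end Literature.NumberTheory.EllipticCurves
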